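/-
Copyright (c) 2026. All rights reserved.
Released under Apache 2.0 license as described in the file LICENSE.
Authors: abc-iut cell, seat abc-iut-f-069 (gen 4; row «DPSC-NODAL-MODEL», complementary half to abc-iut-L4-t6 g7).
-/
import Literature.AnabelianGeometry.EtaleTheta.SettingModelKrullCuspCommTerminal
import Literature.AnabelianGeometry.EtaleTheta.SettingModelCuspAxis
import Literature.AnabelianGeometry.SemiGraphs.ProSigmaCompletionMalnormal
import Literature.AnabelianGeometry.SemiGraphs.ProSigmaCuspInertiaFreeCyclic
import Literature.AnabelianGeometry.AbsoluteAnabelian.FreeProcyclicModel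
import Literature.AnabelianGeometry.AbsoluteAnabelian.ZHatCompletionFreeProcyclic
import Literature.AnabelianGeometry.AbsoluteAnabelian.ZHatCompletionAdicCompleteness
import Literature.AnabelianGeometry.AbsoluteAnabelian.AbsTopII.FreeProcyclicBridge
import HarnessLib

/-!
# [AbsTopII] Def 1.2 (ii) WITH A NODE: the `F̂₂`-internal inputs of the Dehn-twist model, DISCHARGED

S. Mochizuki, *Topics in Absolute Anabelian Geometry II* [AbsTopII] (bib `MochizukiAbsTopII2013`; locators =
PDF pages of the kurims manuscript `paper:url-585b8d0ad0d9`), §1, Def 1.2 (ii) p. 10 and Prop 1.3 (i)–(iii)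
p. 11; S. Mochizuki, *A combinatorial version of the Grothendieck conjecture* [CombGC] (`MochizukiCombGC2007`)
Prop 1.2 (ii) p. 8 / Rmk 1.1.3 p. 7 (commensurable terminality / slimness of verticial and edge-like subgroups);
[SemiAnbd] (`MochizukiSemiAnbd2006`) Example 2.10 p. 31 (cusp inertia in pro-`Σ` surface groups is malnormal).

PROOF-ONLY companion (no definition, no instance), abc-iut-f-069 (gen 4), row «DPSC-NODAL-MODEL» of
abc-iut-L4-t6 g7 (S1 `AbsTopII/DehnTwistExtension.lean` p453388: `Π_I = F̂₂ ⋊_{shear^i} Ẑ`; S2 the loop-graph PSC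
datum on `F̂₂` with `Π_e := b^Ẑ` (`bAxis`), `Π_v := ⟨b^Ẑ, a·b^Ẑ·a⁻¹⟩^`, `Π_c := ⟨[a,b]⟩^`; S3 the Prop 1.3 (ii′)
computations).  S3 names as HYPOTHESES the following facts INSIDE `F̂₂ = ⟨a, b⟩^` (`a = η x₀` the stable letter of
the loop, `b = η x₁` the vanishing cycle); this file DISCHARGES them from theorems already in the tree (layer
L3's pro-`Σ` surface-group currency and layer L2's [EtTh] setting-model bricks, consumed BY NAME, nothing restated):

* §1 `bAxis_eq_closure_zpowers` — abc-iut-L2's `bAxis = b^Ẑ` (range of `b^· : Ẑ → F̂₂`) IS the closure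
  `⟨η x₁⟩^` (the shape in which layer L3's theorems speak);
* §2 `exists_gamma03_completion` — `F̂₂` as the pro-(all primes) completion of `Γ_{0,3} = ⟨c₁,c₂,c₃ ∣ c₁c₂c₃⟩`
  with `c₂ ↦ a`, `c₃ ↦ b` (abc-iut-L3's `PuncturedSurfaceGroup.freeEquiv 0 2`): the vanishing cycle `b` and the
  stable letter `a` are CUSP GENERATORS of the thrice-punctured sphere — the normalisation of the nodal curve;
* §3 `isCommensurablyTerminal_bAxis` (and `…_closure_zpowers_eta_zero`) — `Π_e = b^Ẑ` (and `a^Ẑ`) is commensurably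
  terminal in `F̂₂` ([CombGC] Prop 1.2 (ii) for the node of the loop datum; L3 `cuspInertia_closure_isCommensurablyTerminal`);
  hence §4 `centralizer_bAxis_eq`, `normalizer_bAxis_eq`: `Z_{F̂₂}(b^Ẑ) = N_{F̂₂}(b^Ẑ) = b^Ẑ` (S3's `hZb`);
* §5 `eta_zero_not_mem_bAxis`, `bAxis_inf_conj_eta_zero_eq_bot` — `a ∉ b^Ẑ` and `b^Ẑ ∩ a·b^Ẑ·a⁻¹ = 1`
  (malnormality, L3 `closure_zpowers_inf_conj_eq_bot`): the two branches of the node meet trivially;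
* §6 `centralizer_eq_bot_of_branches_mem` — ANY subset of `F̂₂` containing the two branch generators `b`, `aba⁻¹`
  has trivial centralizer; in particular `Z_{F̂₂}(Π_v) = 1` for `Π_v = ⟨b^Ẑ ⊔ a·b^Ẑ·a⁻¹⟩^` (S3's `hZv`,
  `centralizer_vertClosure_eq_bot`) and for the S2 spelling `⟨b, aba⁻¹⟩^` (`centralizer_vertClosure'_eq_bot`);
* §7 `isFreeProSigmaCyclic_bAxis`, `isFreeProSigmaCyclic_cAxis`, `isFreeProSigmaCyclic_closure_zpowers_commutator` —
  "`≅ Ẑ^Σ` as abstract profinite groups" (`Σ` = all primes) for the node group `b^Ẑ` and the cusp group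
  `⟨[a,b]⟩^ = c^Ẑ` (abc-iut-L2's `bAxisEquiv`/`cAxisEquiv : _ ≃ₜ* Ẑ` and `isFreeProcyclic_zHatCompletion`);
  `isCommensurablyTerminal_closure_zpowers_commutator` — the cusp group is commensurably terminal (abc-iut-L2-t5's
  `isCommensurablyTerminal_cAxis`, respelled on the closure).
HONEST FRAMING: classical profinite group theory about the free profinite group of rank 2 under OUR kernel check
(constructed ≠ geometric); consistency inputs for a constructed DPSC datum; nothing here bears on [IUTchIII] Cor 3.12
or takes a side on any author; typed ≠ proved for anything not proved here.
-/

noncomputable section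

open scoped Pointwise commutatorElement

namespace Literature.AnabelianGeometry.AbsoluteAnabelian.AbsTopII.DehnTwist

open Literature.AnabelianGeometry.EtaleTheta.SettingModel
open Literature.AnabelianGeometry.SemiGraphs
open Literature.AnabelianGeometry.AbsoluteAnabelian
open Literature.GroupTheory.CombinatorialGroupTheory
open Function _root_.Topology

/-! ### §1 The `b`-axis is the closure of `⟨η x₁⟩` -/

/-- **`b^Ẑ = ⟨η x₁⟩^`**: abc-iut-L2's `bAxis` (the range of the continuous `b^· : Ẑ → F̂₂`, `ι1 ↦ η x₁`) is the
closure of the cyclic subgroup on the vanishing cycle `b = η x₁` (`ι(ℤ)` is dense in `Ẑ`, `b^·` is continuous with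
closed range).  [cite: MochizukiAbsTopII2013, Def 1.2 (ii) p.10] -/
theorem bAxis_eq_closure_zpowers : bAxis = (Subgroup.zpowers (eta (FreeGroup.of 1))).topologicalClosure := by
  refine le_antisymm ?_ (Subgroup.topologicalClosure_minimal _ ?_ isClosed_bAxis)
  · rintro _ ⟨t, rfl⟩
    have hdense : DenseRange iotaZ :=
      ProfiniteGrp.ProfiniteCompletion.denseRange (G := GrpCat.of (Multiplicative ℤ))
    have ht : t ∈ closure (Set.range iotaZ) := hdense.closure_range ▸ Set.mem_univ t
    have himg : bPow t ∈ closure (bPow '' Set.range iotaZ) :=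
      image_closure_subset_closure_image bPow.continuous ⟨t, ht, rfl⟩
    change bPow t ∈ closure ((Subgroup.zpowers (eta (FreeGroup.of 1)) : Subgroup F₂hatT) : Set F₂hatT)
    refine closure_mono ?_ himg
    rintro _ ⟨_, ⟨k, rfl⟩, rfl⟩
    change bPow (iotaZ k) ∈ (Subgroup.zpowers (eta (FreeGroup.of 1)) : Set F₂hatT)
    rw [bPow_iotaZ]
    exact Subgroup.zpow_mem_zpowers _ _
  · rw [Subgroup.zpowers_le]
    exact eta_of_one_mem_bAxis

/-- `b^Ẑ` is abelian (a quotient of `Ẑ`). [cite: MochizukiAbsTopII2013, Prop 1.3 (ii) p.11] -/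
theorem commute_of_mem_bAxis {x y : F₂hatT} (hx : x ∈ bAxis) (hy : y ∈ bAxis) : x * y = y * x := by
  obtain ⟨s, rfl⟩ := hx
  obtain ⟨t, rfl⟩ := hy
  change bPow s * bPow t = bPow t * bPow s
  rw [← map_mul, ← map_mul, ZHatCompletion.mul_comm]

/-! ### §2 `F̂₂` as the profinite completion of the thrice-punctured sphere group `Γ_{0,3}` -/

/-- **The normalisation bridge**: a homomorphism `ι : Γ_{0,3} → F̂₂` which is a pro-(all primes) completion
(layer L3's `IsProSigmaCompletion`) and carries the cusp generators `c₂ ↦ a = η x₀`, `c₃ ↦ b = η x₁`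
(`ι := η ∘ (Γ_{0,3} ≅ F(x₀,x₁))`, abc-iut-L3's `freeEquiv 0 2`: `c_{j+1} ↦ x_j`).  The two branch data of the
loop node (`b`, and `a` the stable letter) are cusps of the normalisation `ℙ¹ ∖ {0,1,∞}`.
[cite: MochizukiAbsTopII2013, Ex 1.1 (ii) p.9] [cite: MochizukiSemiAnbd2006, Ex. 2.10 p.31] -/
theorem exists_gamma03_completion :
    ∃ ι : PuncturedSurfaceGroup 0 (2 + 1) →* F₂hatT,
      SemiGraphOfAnabelioids.IsProSigmaCompletion {p : ℕ | p.Prime} ι ∧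
        ι (PuncturedSurfaceGroup.c 1) = eta (FreeGroup.of 0) ∧ ι (PuncturedSurfaceGroup.c 2) = eta (FreeGroup.of 1) := by
  let e : PuncturedSurfaceGroup 0 (2 + 1) ≃* F₂ :=
    (PuncturedSurfaceGroup.freeEquiv 0 2).trans
      (FreeGroup.freeGroupCongr (Equiv.emptySum (Fin 0 × Bool) (Fin 2)))
  refine ⟨eta.comp e.toMonoidHom,
    (SemiGraphOfAnabelioids.IsProSigmaCompletion.isProSigmaCompletion_toCompletion F₂).comp_mulEquiv e, ?_, ?_⟩
  · have h1 : e (PuncturedSurfaceGroup.c 1) = FreeGroup.of 0 := by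
      change FreeGroup.freeGroupCongr _ (PuncturedSurfaceGroup.freeEquiv 0 2 (PuncturedSurfaceGroup.c (Fin.succ 0))) = _
      rw [PuncturedSurfaceGroup.freeEquiv_c_succ, FreeGroup.freeGroupCongr_apply, FreeGroup.map.of,
        Equiv.emptySum_apply_inr]
    rw [MonoidHom.comp_apply, MulEquiv.coe_toMonoidHom, h1]
  · have h2 : e (PuncturedSurfaceGroup.c 2) = FreeGroup.of 1 := by
      change FreeGroup.freeGroupCongr _ (PuncturedSurfaceGroup.freeEquiv 0 2 (PuncturedSurfaceGroup.c (Fin.succ 1))) = _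
      rw [PuncturedSurfaceGroup.freeEquiv_c_succ, FreeGroup.freeGroupCongr_apply, FreeGroup.map.of,
        Equiv.emptySum_apply_inr]
    rw [MonoidHom.comp_apply, MulEquiv.coe_toMonoidHom, h2]

/-- `Γ_{0,3}` is of hyperbolic type (`2 < 2·0 + 3`). [cite: MochizukiSemiAnbd2006, Ex. 2.10 p.31] -/
theorem isHyperbolicType_zero_three : PuncturedSurfaceGroup.IsHyperbolicType 0 (2 + 1) := by
  change 2 < 2 * 0 + (2 + 1); norm_num

/-! ### §3 Commensurable terminality of the node group `b^Ẑ` (and of `a^Ẑ`) -/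

/-- **`Π_e = b^Ẑ` is commensurably terminal in `F̂₂`** — [CombGC] Prop 1.2 (ii) for the nodal edge-like subgroup
of the loop datum, obtained from layer L3's [SemiAnbd] Ex. 2.10 theorem (`cuspInertia_closure_isCommensurablyTerminal`)
at the cusp `c₃ ↦ b` of `Γ_{0,3}`. [cite: MochizukiCombGC2007, Prop 1.2 p.8] [cite: MochizukiSemiAnbd2006, Ex. 2.10 p.31] -/
theorem isCommensurablyTerminal_bAxis : IsCommensurablyTerminal bAxis := by
  obtain ⟨ι, hι, -, h2⟩ := exists_gamma03_completion
  have hT := SemiGraphOfAnabelioids.cuspInertia_closure_isCommensurablyTerminal (P := F₂hatT)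
    (Sigma := {p : ℕ | p.Prime}) ⟨2, Nat.prime_two⟩ (fun p hp => hp) isHyperbolicType_zero_three ι hι 2
  have hmap : ((PuncturedSurfaceGroup.cuspInertia (g := 0) (2 : Fin (2 + 1))).map ι) =
      Subgroup.zpowers (eta (FreeGroup.of 1)) := by
    rw [PuncturedSurfaceGroup.cuspInertia, MonoidHom.map_zpowers, h2]
  rwa [hmap, ← bAxis_eq_closure_zpowers] at hT

/-- **`a^Ẑ := ⟨η x₀⟩^` is commensurably terminal in `F̂₂`** (the same at the cusp `c₂ ↦ a` of `Γ_{0,3}`).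
[cite: MochizukiCombGC2007, Prop 1.2 p.8] [cite: MochizukiSemiAnbd2006, Ex. 2.10 p.31] -/
theorem isCommensurablyTerminal_closure_zpowers_eta_zero :
    IsCommensurablyTerminal (Subgroup.zpowers (eta (FreeGroup.of 0))).topologicalClosure := by
  obtain ⟨ι, hι, h1, -⟩ := exists_gamma03_completion
  have hT := SemiGraphOfAnabelioids.cuspInertia_closure_isCommensurablyTerminal (P := F₂hatT)
    (Sigma := {p : ℕ | p.Prime}) ⟨2, Nat.prime_two⟩ (fun p hp => hp) isHyperbolicType_zero_three ι hι 1
  have hmap : ((PuncturedSurfaceGroup.cuspInertia (g := 0) (1 : Fin (2 + 1))).map ι) =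
      Subgroup.zpowers (eta (FreeGroup.of 0)) := by
    rw [PuncturedSurfaceGroup.cuspInertia, MonoidHom.map_zpowers, h1]
  rwa [hmap] at hT

/-! ### §4 Centralizer and normalizer of the node group -/

/-- `η x₁ ≠ 1` in `F̂₂` (`η` is injective). [cite: MochizukiAbsTopII2013, Def 1.2 (ii) p.10] -/
theorem eta_one_ne_one : eta (FreeGroup.of (1 : Fin 2)) ≠ 1 := by
  intro h
  have := eta_injective (h.trans (map_one eta).symm)
  exact FreeGroup.of_ne_one _ this

/-- An element of `F̂₂` commuting with the vanishing cycle `b = η x₁` lies on `b^Ẑ` (layer L3's malnormality engine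
`mem_closure_zpowers_of_commute` for the free basis `{x₀, x₁}`). [cite: MochizukiSemiAnbd2006, Ex. 2.10 p.31] -/
theorem mem_bAxis_of_commute_eta_one {z : F₂hatT} (hz : Commute z (eta (FreeGroup.of 1))) : z ∈ bAxis := by
  rw [bAxis_eq_closure_zpowers]
  have hb : (FreeGroupBasis.ofFreeGroup (Fin 2)) 1 = FreeGroup.of 1 := FreeGroupBasis.ofFreeGroup_apply 1
  have h := SemiGraphOfAnabelioids.IsProSigmaCompletion.mem_closure_zpowers_of_commute (P := F₂hatT)
    (ι := eta) (FreeGroupBasis.ofFreeGroup (Fin 2)) 1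
    (SemiGraphOfAnabelioids.IsProSigmaCompletion.isProSigmaCompletion_toCompletion F₂)
    (x := z) (y := eta (FreeGroup.of 1)) (by rw [hb]; exact Subgroup.le_topologicalClosure _ (Subgroup.mem_zpowers _))
    eta_one_ne_one hz
  rwa [hb] at h

/-- **`Z_{F̂₂}(b^Ẑ) = b^Ẑ`** (S3's hypothesis `hZb`): `⊇` as `b^Ẑ` is abelian, `⊆` by the malnormality engine.
[cite: MochizukiAbsTopII2013, Prop 1.3 (ii) p.11] [cite: MochizukiCombGC2007, Prop 1.2 p.8] -/
theorem centralizer_bAxis_eq : Subgroup.centralizer (bAxis : Set F₂hatT) = bAxis := by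
  refine le_antisymm (fun z hz => ?_) (fun z hz => ?_)
  · rw [Subgroup.mem_centralizer_iff] at hz
    exact mem_bAxis_of_commute_eta_one (commute_iff_eq _ _ |>.mpr (hz _ eta_of_one_mem_bAxis).symm)
  · rw [Subgroup.mem_centralizer_iff]
    intro y hy
    exact commute_of_mem_bAxis hy hz

/-- **`N_{F̂₂}(b^Ẑ) = b^Ẑ`** (commensurably terminal ⇒ normally terminal). [cite: MochizukiCombGC2007, Prop 1.2 p.8] -/
theorem normalizer_bAxis_eq : Subgroup.normalizer (bAxis : Set F₂hatT) = bAxis :=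
  isCommensurablyTerminal_bAxis.isNormallyTerminal.normalizer_eq

/-- The commensurator of `b^Ẑ` in `F̂₂` is `b^Ẑ` (restatement of §3 as an equation).
[cite: MochizukiCombGC2007, Prop 1.2 p.8] -/
theorem commensurator_bAxis_eq : Subgroup.Commensurable.commensurator bAxis = bAxis :=
  isCommensurablyTerminal_bAxis.commensurator_eq

/-! ### §5 The two branches of the node meet trivially (malnormality) -/

/-- The stable letter does not lie on the `b`-axis: `a = η x₀ ∉ b^Ẑ` (its `a`-exponent `ê(a) = ι1 ≠ 1`, whereas
`ê ≡ 1` on `b^Ẑ`). [cite: MochizukiAbsTopII2013, Ex 1.1 (ii) p.9] -/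
theorem eta_zero_not_mem_bAxis : eta (FreeGroup.of 0) ∉ bAxis := by
  intro h
  have h1 := eHat_eq_one_of_mem_bAxis h
  rw [eHat_eta, expA_of_zero] at h1
  have h2 := iotaZ_injective (h1.trans (map_one iotaZ).symm)
  exact one_ne_zero (Multiplicative.ofAdd.injective h2)

/-- **Malnormality of the node group**: `b^Ẑ ∩ x·b^Ẑ·x⁻¹ = 1` for every `x ∉ b^Ẑ` (layer L3's
`closure_zpowers_inf_conj_eq_bot`, [SemiAnbd] Ex. 2.10). [cite: MochizukiSemiAnbd2006, Ex. 2.10 p.31] -/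
theorem bAxis_inf_conj_eq_bot_of_not_mem {x : F₂hatT} (hx : x ∉ bAxis) :
    bAxis ⊓ MulAut.conj x • bAxis = ⊥ := by
  rw [bAxis_eq_closure_zpowers] at hx ⊢
  have hb : (FreeGroupBasis.ofFreeGroup (Fin 2)) 1 = FreeGroup.of 1 := FreeGroupBasis.ofFreeGroup_apply 1
  have h := SemiGraphOfAnabelioids.IsProSigmaCompletion.closure_zpowers_inf_conj_eq_bot (P := F₂hatT)
    (ι := eta) (FreeGroupBasis.ofFreeGroup (Fin 2)) 1
    (SemiGraphOfAnabelioids.IsProSigmaCompletion.isProSigmaCompletion_toCompletion F₂) (x := x) (by rwa [hb])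
  rw [hb] at h
  rwa [conj_smul_eq_toConjAct_smul]

/-- **The two branches of the loop node meet trivially**: `b^Ẑ ∩ a·b^Ẑ·a⁻¹ = 1`.
[cite: MochizukiAbsTopII2013, Prop 1.3 (ii) p.11] [cite: MochizukiSemiAnbd2006, Ex. 2.10 p.31] -/
theorem bAxis_inf_conj_eta_zero_eq_bot : bAxis ⊓ MulAut.conj (eta (FreeGroup.of 0)) • bAxis = ⊥ :=
  bAxis_inf_conj_eq_bot_of_not_mem eta_zero_not_mem_bAxis

/-! ### §6 Centralizers of the vertex group -/

/-- **Anything centralising both branch generators `b` and `a b a⁻¹` is trivial**: `Z_{F̂₂}(S) = 1` for every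
`S ∋ b, aba⁻¹` (a centraliser of `b` lies on `b^Ẑ`, a centraliser of `aba⁻¹` on `a·b^Ẑ·a⁻¹`, and these meet
trivially).  [cite: MochizukiAbsTopII2013, Prop 1.3 (iii) p.11] [cite: MochizukiCombGC2007, Rmk 1.1.3 p.7] -/
theorem centralizer_eq_bot_of_branches_mem {S : Set F₂hatT} (hb : eta (FreeGroup.of 1) ∈ S)
    (hab : eta (FreeGroup.of 0) * eta (FreeGroup.of 1) * (eta (FreeGroup.of 0))⁻¹ ∈ S) :
    Subgroup.centralizer S = ⊥ := by
  rw [eq_bot_iff]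
  intro z hz
  rw [Subgroup.mem_centralizer_iff] at hz
  have hzb : z ∈ bAxis := mem_bAxis_of_commute_eta_one (commute_iff_eq _ _ |>.mpr (hz _ hb).symm)
  -- `a⁻¹ z a` commutes with `b`, so lies on `b^Ẑ`, i.e. `z ∈ a·b^Ẑ·a⁻¹`
  have hconj : Commute ((eta (FreeGroup.of 0))⁻¹ * z * eta (FreeGroup.of 0)) (eta (FreeGroup.of 1)) := by
    have h := hz _ hab
    rw [commute_iff_eq]
    calc (eta (FreeGroup.of 0))⁻¹ * z * eta (FreeGroup.of 0) * eta (FreeGroup.of 1)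
        = (eta (FreeGroup.of 0))⁻¹ * (z * (eta (FreeGroup.of 0) * eta (FreeGroup.of 1) *
            (eta (FreeGroup.of 0))⁻¹)) * eta (FreeGroup.of 0) := by group
      _ = (eta (FreeGroup.of 0))⁻¹ * ((eta (FreeGroup.of 0) * eta (FreeGroup.of 1) *
            (eta (FreeGroup.of 0))⁻¹) * z) * eta (FreeGroup.of 0) := by rw [h]
      _ = eta (FreeGroup.of 1) * ((eta (FreeGroup.of 0))⁻¹ * z * eta (FreeGroup.of 0)) := by group
  have hza : z ∈ MulAut.conj (eta (FreeGroup.of 0)) • bAxis := by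
    rw [Subgroup.mem_smul_pointwise_iff_exists]
    refine ⟨(eta (FreeGroup.of 0))⁻¹ * z * eta (FreeGroup.of 0), mem_bAxis_of_commute_eta_one hconj, ?_⟩
    rw [MulAut.smul_def, MulAut.conj_apply]; group
  have : z ∈ bAxis ⊓ MulAut.conj (eta (FreeGroup.of 0)) • bAxis := ⟨hzb, hza⟩
  rwa [bAxis_inf_conj_eta_zero_eq_bot] at this

/-- **`Z_{F̂₂}(Π_v) = 1`** for the verticial representative `Π_v = ⟨b^Ẑ ⊔ a·b^Ẑ·a⁻¹⟩^` of the loop datum (S3's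
hypothesis `hZv`). [cite: MochizukiAbsTopII2013, Prop 1.3 (iii) p.11] [cite: MochizukiCombGC2007, Rmk 1.1.3 p.7] -/
theorem centralizer_vertClosure_eq_bot :
    Subgroup.centralizer (((bAxis ⊔ MulAut.conj (eta (FreeGroup.of 0)) • bAxis).topologicalClosure :
      Subgroup F₂hatT) : Set F₂hatT) = ⊥ := by
  refine centralizer_eq_bot_of_branches_mem ?_ ?_
  · exact Subgroup.le_topologicalClosure _ (Subgroup.mem_sup_left eta_of_one_mem_bAxis)
  · refine Subgroup.le_topologicalClosure _ (Subgroup.mem_sup_right ?_)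
    rw [Subgroup.mem_smul_pointwise_iff_exists]
    exact ⟨eta (FreeGroup.of 1), eta_of_one_mem_bAxis, by rw [MulAut.smul_def, MulAut.conj_apply]⟩

/-- `Z_{F̂₂}(Π_v) = 1` for the S2 spelling `Π_v = ⟨b, aba⁻¹⟩^` (closure of the subgroup generated by the two
branch generators). [cite: MochizukiAbsTopII2013, Prop 1.3 (iii) p.11] [cite: MochizukiCombGC2007, Rmk 1.1.3 p.7] -/
theorem centralizer_vertClosure'_eq_bot :
    Subgroup.centralizer (((Subgroup.closure ({eta (FreeGroup.of 1),
      eta (FreeGroup.of 0) * eta (FreeGroup.of 1) * (eta (FreeGroup.of 0))⁻¹} : Set F₂hatT)).topologicalClosure :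
      Subgroup F₂hatT) : Set F₂hatT) = ⊥ := by
  refine centralizer_eq_bot_of_branches_mem ?_ ?_
  · exact Subgroup.le_topologicalClosure _ (Subgroup.subset_closure (Set.mem_insert _ _))
  · exact Subgroup.le_topologicalClosure _ (Subgroup.subset_closure (Set.mem_insert_of_mem _ rfl))

/-- In particular `F̂₂` is centre-free, re-derived from the branch pair (the tree's theorem of record is
abc-iut-L2's `center_F₂hat_eq_bot`). [cite: MochizukiCombGC2007, Rmk 1.1.3 p.7] -/
theorem centralizer_univ_eq_bot : Subgroup.centralizer (Set.univ : Set F₂hatT) = ⊥ :=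
  centralizer_eq_bot_of_branches_mem (Set.mem_univ _) (Set.mem_univ _)

/-! ### §7 "`≅ Ẑ^Σ`" for the node group and the cusp group; the cusp group is commensurably terminal -/

/-- For `Σ` = all primes, `Σ`-integer means positive (the index condition of "`≅ Ẑ^Σ`" at `Σ = 𝔓𝔯𝔦𝔪𝔢𝔰`).
[cite: MochizukiAbsTopII2013, Prop 1.3 (i) p.11] -/
theorem isSigmaInteger_primes_iff (n : ℕ) :
    Literature.AnabelianGeometry.Anabelioids.IsSigmaInteger {p : ℕ | p.Prime} n ↔ 0 < n :=
  ⟨fun h => h.1, fun h => ⟨h, fun _ hp _ => hp⟩⟩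

/-- `IsFreeProSigmaCyclic` at `Σ` = the set of all primes is `IsFreeProSigmaCyclic Set.univ` (both index
conditions say "positive"). [cite: MochizukiAbsTopII2013, Prop 1.3 (i) p.11] -/
theorem isFreeProSigmaCyclic_primes_iff_univ {G : Type*} [Group G] [TopologicalSpace G] :
    IsFreeProSigmaCyclic {p : ℕ | p.Prime} G ↔ IsFreeProSigmaCyclic Set.univ G := by
  constructor
  · intro h
    exact ⟨h.exists_dense_zpowers, fun n => (h.isOpen_index_iff n).trans
      ((isSigmaInteger_primes_iff n).trans ⟨fun hn => ⟨hn, fun _ _ _ => Set.mem_univ _⟩, fun hn => hn.1⟩)⟩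
  · intro h
    exact ⟨h.exists_dense_zpowers, fun n => (h.isOpen_index_iff n).trans
      (⟨fun hn => (isSigmaInteger_primes_iff n).mpr hn.1, fun hn => ⟨hn.1, fun _ _ _ => Set.mem_univ _⟩⟩)⟩

/-- `Ẑ` (abc-iut-L2's carrier `ZH = ZHat`) is free pro-`Σ`-cyclic for `Σ` = all primes.
[cite: MochizukiAbsTopII2013, Prop 1.3 (i) p.11] -/
theorem isFreeProSigmaCyclic_ZH : IsFreeProSigmaCyclic {p : ℕ | p.Prime} ZH :=
  isFreeProSigmaCyclic_primes_iff_univ.mpr isFreeProcyclic_zHatCompletion.isFreeProSigmaCyclic_univ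

/-- **`Π_e = b^Ẑ ≅ Ẑ^Σ`** (`Σ` = all primes) as an abstract profinite group (abc-iut-L2's `bAxisEquiv : b^Ẑ ≃ₜ* Ẑ`).
[cite: MochizukiAbsTopII2013, Prop 1.3 (ii) p.11] -/
theorem isFreeProSigmaCyclic_bAxis : IsFreeProSigmaCyclic {p : ℕ | p.Prime} ↥bAxis :=
  IsFreeProSigmaCyclic.of_continuousMulEquiv bAxisEquiv.symm isFreeProSigmaCyclic_ZH

/-- **`c^Ẑ ≅ Ẑ^Σ`** (`Σ` = all primes) for abc-iut-L2's commutator axis (`cAxisEquiv : c^Ẑ ≃ₜ* Ẑ`).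
[cite: MochizukiAbsTopII2013, Prop 1.3 (i) p.11] -/
theorem isFreeProSigmaCyclic_cAxis : IsFreeProSigmaCyclic {p : ℕ | p.Prime} ↥cAxis :=
  IsFreeProSigmaCyclic.of_continuousMulEquiv cAxisEquiv.symm isFreeProSigmaCyclic_ZH

/-- The S2 cusp representative IS the commutator axis: `⟨a b a⁻¹ b⁻¹⟩^ = c^Ẑ` (abc-iut-L2's
`cAxis_eq_closure_zpowers`, `η⁅x₀,x₁⁆ = a b a⁻¹ b⁻¹`). [cite: MochizukiCombGC2007, Def 1.1(ii) p.7] -/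
theorem closure_zpowers_commutator_eq_cAxis :
    (Subgroup.zpowers (eta (FreeGroup.of 0) * eta (FreeGroup.of 1) * (eta (FreeGroup.of 0))⁻¹ *
      (eta (FreeGroup.of 1))⁻¹)).topologicalClosure = cAxis := by
  have h : eta cElt = eta (FreeGroup.of 0) * eta (FreeGroup.of 1) * (eta (FreeGroup.of 0))⁻¹ *
      (eta (FreeGroup.of 1))⁻¹ := by
    change eta ⁅FreeGroup.of (0 : Fin 2), FreeGroup.of 1⁆ = _
    rw [commutatorElement_def, map_mul, map_mul, map_mul, map_inv, map_inv]
  rw [cAxis_eq_closure_zpowers, h]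

/-- **Prop 1.3 (i) input at the nodal datum: the cusp group `Π_c = ⟨[a,b]⟩^ ≅ Ẑ^Σ`** (`Σ` = all primes).
[cite: MochizukiAbsTopII2013, Prop 1.3 (i) p.11] [cite: MochizukiCombGC2007, Rmk 1.1.3 p.7] -/
theorem isFreeProSigmaCyclic_closure_zpowers_commutator :
    IsFreeProSigmaCyclic {p : ℕ | p.Prime}
      ↥(Subgroup.zpowers (eta (FreeGroup.of 0) * eta (FreeGroup.of 1) * (eta (FreeGroup.of 0))⁻¹ *
        (eta (FreeGroup.of 1))⁻¹)).topologicalClosure := by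
  rw [closure_zpowers_commutator_eq_cAxis]
  exact isFreeProSigmaCyclic_cAxis

/-- **The cusp group `Π_c = ⟨[a,b]⟩^` is commensurably terminal in `F̂₂`** ([CombGC] Prop 1.2 (ii) for the cusp of
the loop datum; abc-iut-L2-t5's `isCommensurablyTerminal_cAxis`, i.e. [SemiAnbd] Ex. 2.10 at `Γ_{1,1}`).
[cite: MochizukiCombGC2007, Prop 1.2 p.8] [cite: MochizukiSemiAnbd2006, Ex. 2.10 p.31] -/
theorem isCommensurablyTerminal_closure_zpowers_commutator :
    IsCommensurablyTerminal
      (Subgroup.zpowers (eta (FreeGroup.of 0) * eta (FreeGroup.of 1) * (eta (FreeGroup.of 0))⁻¹ *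
        (eta (FreeGroup.of 1))⁻¹)).topologicalClosure := by
  rw [closure_zpowers_commutator_eq_cAxis]
  exact isCommensurablyTerminal_cAxis

/-- `Z_{F̂₂}(Π_c) = N_{F̂₂}(Π_c) = Π_c` for the cusp group, as equations on the commutator axis.
[cite: MochizukiCombGC2007, Prop 1.2 p.8] -/
theorem normalizer_cAxis_eq : Subgroup.normalizer (cAxis : Set F₂hatT) = cAxis :=
  isCommensurablyTerminal_cAxis.isNormallyTerminal.normalizer_eq

end Literature.AnabelianGeometry.AbsoluteAnabelian.AbsTopII.DehnTwist

end
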